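import Summits.QuantumFields.YangMills.Theorems.ComplexCouplingChannelTubeZeroFreeChannelStubVesRep
import Summits.QuantumFields.YangMills.Theorems.ComplexCouplingChannelTubeZeroFreeChannelStubTubeRateLimit
import Literature.MathematicalPhysics.QuantumLattice.NonlinearPlaquetteActionFirstOrder
import Literature.MathematicalPhysics.QuantumLattice.GaugeGroupsProofs

/-!
# A free-energy WALL at an admissible pair, modulo van Enter–Shlosman: the strip corridor is false

Negative-side consequences for the crux `TubeZeroFreeChannel` (stmt-QuantumFields-18841, route
`ComplexCouplingChannel`) of ONE named Literature fact, `vanEnterShlosman_firstOrder` (van Enter–Shlosman,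
CMP 255 (2005) Thm 2, special case `SU(2)`, `d = 4`; unproved in the tree), combined with the LANDED lemmas of line
`legendre-capped-pocket`: the vES representation `r_p` (`stub_vesRep`), the tube rates (`stub_tubeRate`) and their
bulk limit (`stub_tubeRateLimit`), and the disprover's `AxisBlocking` theorems.

* `exists_wallLimits` — UNCONDITIONAL: at every admissible `(G, r)` and `c > 0` the tube rates exist (`L ≥ 1`) and
  converge to `freeEnergyDensity 4 r.ρ` on `|x − c| < c` (the limit hypotheses of `HasWall` / `analyticAt_of_boxZ_zeroFree`).
* `exists_wall_of_vanEnterShlosman` — modulo the fact, an ADMISSIBLE pair `(SU(2), r_p)` carries a wall: a real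
  `c > 0` with tube rates `e L x = log λ₊(x, L)/L³` (`L ≥ 1`) and bulk free energy `f = freeEnergyDensity 4 r.ρ` on
  `|x − c| < c`, `f` NOT real analytic at `c` (this is `Cruxes/…/Disproof.lean` §5 NEAR-MISS 1 `exists_wall_vES`,
  now a theorem modulo one print result instead of a `sorry`).
* `not_stripChannel_of_vanEnterShlosman` — modulo the fact, the axis-hugging STRIP form of the crux (the 2001 x5
  corridor: a whole `δ`-box about `[0, β]` uniformly zero-free) is FALSE.
* `channel_detours_of_vanEnterShlosman` — modulo the fact, IF the crux holds then at `(SU(2), r_p)` every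
  large `β` has a channel (tolerance `ρ = c`) that misses `c` and crosses `Re z = c` off the axis: any proof of the
  crux must leave the real axis.

All three are CONDITIONAL on `vanEnterShlosman_firstOrder` (an explicit hypothesis; trust base = that name).
-/

set_option autoImplicit false

noncomputable section

namespace Summit.QuantumFields.YangMills.Theorems.TubeZeroFreeChannel.Negative

open scoped Topology
open Filter Set Metric MeasureTheory
open Literature.MathematicalPhysics.QuantumFieldTheory (LatticeRep IsCompactSimpleLieGroup
  isCompactSimpleLieGroup_specialUnitaryGroup transferSpectralRadius)
open Literature.MathematicalPhysics.QuantumLattice (isSimpleCompactGroup_specialUnitaryGroup_holds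
  freeEnergyDensity vanEnterShlosman_firstOrder)
open Summit.QuantumFields.YangMills.Theses.ComplexCouplingChannel (TubeZeroFreeChannel)
open Summit.QuantumFields.YangMills.Theorems.TubeZeroFreeChannel (stub_vesRep stub_tubeRate stub_tubeRateLimit)

/-- **Wall data at every positive coupling, unconditionally except for analyticity**: for every admissible
`(G, r)` and `c > 0` there are tube rates `e L x` (namely `log λ₊(x, L)/L³`, `λ₊ = transferSpectralRadius r.ρ x L`,
for `L ≥ 1`) converging to `freeEnergyDensity 4 r.ρ` on `|x − c| < c` (landed `stub_tubeRate`, `stub_tubeRateLimit`).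
[folklore] -/
theorem exists_wallLimits {G : Type} [Group G] [TopologicalSpace G] [IsTopologicalGroup G] [CompactSpace G]
    [MeasurableSpace G] [BorelSpace G] (r : LatticeRep G) {c : ℝ} (_hc : 0 < c) :
    ∃ e : ℕ → ℝ → ℝ,
      (∃ L₁ : ℕ, ∀ L, L₁ ≤ L → ∀ x : ℝ, |x - c| < c →
        Tendsto (fun t : ℕ => Real.log ‖boxZ r x L t‖ / ((L : ℝ) ^ 3 * t)) atTop (𝓝 (e L x))) ∧
      (∀ x : ℝ, |x - c| < c → Tendsto (fun L => e L x) atTop (𝓝 (freeEnergyDensity 4 r.ρ x))) := by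
  have hpos : ∀ x : ℝ, |x - c| < c → 0 ≤ x := fun x hx => by
    have := (abs_lt.mp hx).1; linarith
  -- the tube rate `e L x = log λ₊(x, L) / L³` (junk `0` at `L = 0`)
  let e : ℕ → ℝ → ℝ := fun L x =>
    if h : L = 0 then 0 else
      haveI : NeZero L := ⟨h⟩
      Real.log (transferSpectralRadius r.ρ x L) / (L : ℝ) ^ 3
  refine ⟨e, ⟨1, fun L hL x hx => ?_⟩, fun x hx => ?_⟩
  · haveI : NeZero L := ⟨by omega⟩
    simpa only [e, NeZero.ne L, ↓reduceDIte] using stub_tubeRate r x (hpos x hx) L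
  · refine (tendsto_add_atTop_iff_nat (f := fun L : ℕ => e L x) 1).1
      ((stub_tubeRateLimit r x (hpos x hx)).congr fun L => ?_)
    simp only [e, Nat.add_one_ne_zero, ↓reduceDIte]

/-- **A wall at an admissible pair, modulo van Enter–Shlosman** (`Disproof.lean` §5 NEAR-MISS 1 as a conditional
theorem): the fact gives `p₀`; for `p := max p₀ 1` the landed `stub_vesRep` gives `r = r_p : LatticeRep SU(2)` with
the vES action, the fact gives a coupling `c > 0` where `freeEnergyDensity 4 r.ρ` is not differentiable — hence not
real analytic — and `exists_wallLimits` supplies the tube rates and their bulk limit about `c`. [folklore] -/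
theorem exists_wall_of_vanEnterShlosman (h : vanEnterShlosman_firstOrder) :
    ∃ (r : LatticeRep (Matrix.specialUnitaryGroup (Fin 2) ℂ)) (c : ℝ), 0 < c ∧
      ∃ (e : ℕ → ℝ → ℝ) (f : ℝ → ℝ),
        (∃ L₁ : ℕ, ∀ L, L₁ ≤ L → ∀ x : ℝ, |x - c| < c →
          Tendsto (fun t : ℕ => Real.log ‖boxZ r x L t‖ / ((L : ℝ) ^ 3 * t)) atTop (𝓝 (e L x))) ∧
        (∀ x : ℝ, |x - c| < c → Tendsto (fun L => e L x) atTop (𝓝 (f x))) ∧ ¬ AnalyticAt ℝ f c := by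
  obtain ⟨p₀, hp₀⟩ := h
  obtain ⟨r, hr⟩ := stub_vesRep (max p₀ 1) (le_max_right _ _)
  obtain ⟨c, hc, hnd⟩ := hp₀ (max p₀ 1) (le_max_left _ _) r.N r.ρ r.continuous hr
  obtain ⟨e, he, hf⟩ := exists_wallLimits r hc
  exact ⟨r, c, hc, e, fun x => freeEnergyDensity 4 r.ρ x, he, hf, fun ha => hnd ha.differentiableAt⟩

/-- **The strip corridor is false, modulo van Enter–Shlosman.** The axis-hugging strengthening of
`TubeZeroFreeChannel` (a whole `δ`-box about `[0, β]` uniformly zero-free for the tubes, `β` large — the 2001 x5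
corridor, the strategist's `StripCorridor`) fails: instantiate the landed `not_stripChannel_of_wall` at the wall of
`exists_wall_of_vanEnterShlosman`. [folklore] -/
theorem not_stripChannel_of_vanEnterShlosman (h : vanEnterShlosman_firstOrder) :
    ¬ ∀ (G : Type) [Group G] [TopologicalSpace G] [IsTopologicalGroup G] [CompactSpace G]
        [MeasurableSpace G] [BorelSpace G], IsCompactSimpleLieGroup G → ∀ r : LatticeRep G,
        ∃ β₁ : ℝ, ∀ β : ℝ, β₁ ≤ β → ∃ δ : ℝ, 0 < δ ∧
          ∃ L₀ : ℕ, ∀ L : ℕ, L₀ ≤ L → ∃ t₀ : ℕ, ∀ t : ℕ, t₀ ≤ t → ∀ z : ℂ,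
            -δ < z.re → z.re < β + δ → -δ < z.im → z.im < δ → boxZ r z L t ≠ 0 := by
  obtain ⟨r, c, hc, e, f, he, hf, hna⟩ := exists_wall_of_vanEnterShlosman h
  -- `SU(2)` is admissible (simplicity proved in `GaugeGroupsProofs`; also landed as
  -- `OSLegsFromFemtoAndGap.Negative.isCompactSimpleLieGroup_su2`, whose import cone is avoided here)
  exact not_stripChannel_of_wall
    (isCompactSimpleLieGroup_specialUnitaryGroup isSimpleCompactGroup_specialUnitaryGroup_holds le_rfl)
    r hc hc he hf hna

/-- **Every proof of the crux must detour, modulo van Enter–Shlosman.** If `TubeZeroFreeChannel` holds, then at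
the admissible pair `(SU(2), r_p)` with its wall at `c > 0`, for every large `β` the crux's channel at tolerance
`ρ = c` misses `c` and contains a non-real point on `Re z = c` (landed `channel_detours_of_wall`). [folklore] -/
theorem channel_detours_of_vanEnterShlosman (h : vanEnterShlosman_firstOrder) (hT : TubeZeroFreeChannel) :
    ∃ (r : LatticeRep (Matrix.specialUnitaryGroup (Fin 2) ℂ)) (c : ℝ), 0 < c ∧
      ∃ β₁ : ℝ, ∀ β : ℝ, β₁ ≤ β → ∃ D : Set ℂ, IsOpen D ∧ IsConnected D ∧ (β : ℂ) ∈ D ∧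
        (∃ x : ℝ, |x| < c ∧ (x : ℂ) ∈ D) ∧
        (∃ L₀ : ℕ, ∀ L : ℕ, L₀ ≤ L → ∃ t₀ : ℕ, ∀ t : ℕ, t₀ ≤ t → ∀ z ∈ D, boxZ r z L t ≠ 0) ∧
        (c : ℂ) ∉ D ∧ ∃ w ∈ D, w.re = c ∧ w.im ≠ 0 := by
  obtain ⟨r, c, hc, e, f, he, hf, hna⟩ := exists_wall_of_vanEnterShlosman h
  exact ⟨r, c, hc, channel_detours_of_wall hT
    (isCompactSimpleLieGroup_specialUnitaryGroup isSimpleCompactGroup_specialUnitaryGroup_holds le_rfl)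
    r hc hc he hf hna⟩

end Summit.QuantumFields.YangMills.Theorems.TubeZeroFreeChannel.Negative

end
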